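import Literature.Algebra.Homology.OrderedCech
import Mathlib.LinearAlgebra.TensorProduct.Pi
import Mathlib.LinearAlgebra.TensorProduct.Tower
import HarnessLib

/-!
# `Ȟ⁰` of the ordered Čech complex after base change (Görtz–Wedhorn II, Lemma 21.65, (23.28.5))

For the ordered Čech complex `Č•(F)` of a monotone family `F : Finset ι → Submodule A 𝕂`
(`Literature/Algebra/Homology/OrderedCech`) and an `A`-algebra `κ`, the kernel of the
base-changed first differential `d⁰ ⊗ κ : κ ⊗_A Č⁰ → κ ⊗_A Č¹` is the module of **compatible
families**: tuples `(x_σ ∈ κ ⊗_A F σ)_σ` over the vertices `σ = {i}` with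
`x_{min τ}|_τ = x_{max τ}|_τ` in `κ ⊗_A F τ` for every edge `τ = {i < j}`, the "restrictions"
being `κ ⊗ (F{i} ⊆ F{i,j})`. This is the shape in which `Ker(d⁰ ⊗ κ(s))` is compared with
`Γ(X_s, 𝓕_s)` in the base change of the Grothendieck complex (Görtz–Wedhorn II, (23.28.5): the
terms of `Č• ⊗_A κ(s)` are sections of `𝓕_s` over the base-changed affine cover, and `Ȟ⁰ = Γ`
by the sheaf axiom, Lemma 21.65):

* `OrderedCech.piEqualizer` — the submodule of `Π_σ M σ` cut out by conditions
  `α_τ (x (src τ)) = β_τ (x (tgt τ))`, one for each edge `τ`, and its functoriality in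
  componentwise isomorphisms (`piEqualizerCongr`) — the tool by which the geometric side replaces
  `κ ⊗ F{i}` by sections over the fibre;
* `OrderedCech.kerBaseChangeDZeroEquiv` — **`Ker(d⁰ ⊗ κ) ≅` compatible families**
  (`OrderedCech.compatibleFamilies`), `κ`-linearly, via `κ ⊗_A Π_σ F σ ≅ Π_σ κ ⊗_A F σ` (Mathlib
  `TensorProduct.piRight`) and the formula `(d g)_{i<j} = g_j - g_i` (`OrderedCech.coe_d_edge`,
  here `coe_dZero`).

Pure linear algebra, all proved. Mathlib searched (pin): `TensorProduct.piRight`,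
`TensorProduct.piRight_apply`, `TensorProduct.piRightHom_tmul`, `LinearMap.baseChange_tmul`,
`LinearEquiv.ofSubmodules` (used).

## References

* U. Görtz, T. Wedhorn, *Algebraic Geometry II: Cohomology of Schemes*, Springer Spektrum (2023),
  doi:10.1007/978-3-658-43031-3: Lemma 21.65, p. 259; Def. 21.68, p. 260; (23.28.5), p. 482.
  [GortzWedhorn2023]
-/

universe u v w w'

open TensorProduct Finset

namespace Literature.Algebra.Homology

namespace OrderedCech

/-! ### Submodules of a product cut out by edge conditions -/

section PiEqualizer

variable {κ : Type u} [CommRing κ] {V₀ : Type w} {V₁ : Type w'} (src tgt : V₁ → V₀)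
  {M : V₀ → Type v} [∀ σ, AddCommGroup (M σ)] [∀ σ, Module κ (M σ)]
  {N : V₁ → Type v} [∀ τ, AddCommGroup (N τ)] [∀ τ, Module κ (N τ)]
  (α : ∀ τ, M (src τ) →ₗ[κ] N τ) (β : ∀ τ, M (tgt τ) →ₗ[κ] N τ)

/-- The submodule of `Π_σ M σ` of families `x` with `α_τ (x (src τ)) = β_τ (x (tgt τ))` for every
edge `τ`: the equaliser (Mathlib `LinearMap.eqLocus`) of the two maps `Π_σ M σ ⇉ Π_τ N τ`,
`x ↦ (α_τ (x (src τ)))_τ` and `x ↦ (β_τ (x (tgt τ)))_τ` (e.g. compatible families of local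
sections). [folklore] -/
def piEqualizer : Submodule κ (∀ σ, M σ) :=
  LinearMap.eqLocus (LinearMap.pi fun τ => α τ ∘ₗ LinearMap.proj (src τ))
    (LinearMap.pi fun τ => β τ ∘ₗ LinearMap.proj (tgt τ))

variable {src tgt α β}

/-- Membership in `piEqualizer`. [folklore] -/
@[simp] theorem mem_piEqualizer_iff {x : ∀ σ, M σ} :
    x ∈ piEqualizer src tgt α β ↔ ∀ τ, α τ (x (src τ)) = β τ (x (tgt τ)) := by
  simp only [piEqualizer, LinearMap.mem_eqLocus, funext_iff, LinearMap.pi_apply,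
    LinearMap.comp_apply, LinearMap.proj_apply]

variable {M' : V₀ → Type v} [∀ σ, AddCommGroup (M' σ)] [∀ σ, Module κ (M' σ)]
  {N' : V₁ → Type v} [∀ τ, AddCommGroup (N' τ)] [∀ τ, Module κ (N' τ)]
  {α' : ∀ τ, M' (src τ) →ₗ[κ] N' τ} {β' : ∀ τ, M' (tgt τ) →ₗ[κ] N' τ}

variable (α β α' β') in
/-- **Functoriality of `piEqualizer` in componentwise isomorphisms** intertwining the edge maps.
[folklore] -/
def piEqualizerCongr (eM : ∀ σ, M σ ≃ₗ[κ] M' σ) (eN : ∀ τ, N τ ≃ₗ[κ] N' τ)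
    (hα : ∀ τ x, eN τ (α τ x) = α' τ (eM (src τ) x))
    (hβ : ∀ τ x, eN τ (β τ x) = β' τ (eM (tgt τ) x)) :
    piEqualizer src tgt α β ≃ₗ[κ] piEqualizer src tgt α' β' where
  toFun x := ⟨fun σ => eM σ (x.1 σ), mem_piEqualizer_iff.2 fun τ => by
    rw [← hα, ← hβ, (mem_piEqualizer_iff.1 x.2) τ]⟩
  invFun x' := ⟨fun σ => (eM σ).symm (x'.1 σ), mem_piEqualizer_iff.2 fun τ => by
    apply (eN τ).injective
    rw [hα, hβ, LinearEquiv.apply_symm_apply, LinearEquiv.apply_symm_apply,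
      (mem_piEqualizer_iff.1 x'.2) τ]⟩
  map_add' x y := by
    apply Subtype.ext
    funext σ
    exact map_add (eM σ) _ _
  map_smul' c x := by
    apply Subtype.ext
    funext σ
    exact map_smul (eM σ) _ _
  left_inv x := by
    apply Subtype.ext
    funext σ
    exact (eM σ).symm_apply_apply _
  right_inv x' := by
    apply Subtype.ext
    funext σ
    exact (eM σ).apply_symm_apply _

/-- `piEqualizerCongr` acts componentwise by the given isomorphisms. [folklore] -/
theorem piEqualizerCongr_apply (eM : ∀ σ, M σ ≃ₗ[κ] M' σ) (eN : ∀ τ, N τ ≃ₗ[κ] N' τ)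
    (hα : ∀ τ x, eN τ (α τ x) = α' τ (eM (src τ) x))
    (hβ : ∀ τ x, eN τ (β τ x) = β' τ (eM (tgt τ) x)) (x : piEqualizer src tgt α β) (σ : V₀) :
    (piEqualizerCongr α β α' β' eM eN hα hβ x).1 σ = eM σ (x.1 σ) := rfl

end PiEqualizer

/-! ### The two ends of an edge -/

variable {ι : Type} [LinearOrder ι]

/-- Simplices have decidable equality (they are finite subsets of a linear order). [folklore] -/
instance (n : ℤ) : DecidableEq (Simplex ι n) := by
  unfold Simplex; infer_instance

/-- The smaller vertex of a `1`-simplex. [folklore] -/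
def src (τ : Simplex ι 1) : Simplex ι 0 := vertex (τ.1.min' τ.2.1)

/-- The larger vertex of a `1`-simplex. [folklore] -/
def tgt (τ : Simplex ι 1) : Simplex ι 0 := vertex (τ.1.max' τ.2.1)

/-- The smaller vertex of the edge `{a, b}`, `a < b`, is `a`. [folklore] -/
theorem src_edge (a b : ι) (hab : a < b) : src (edge a b hab) = vertex a := by
  unfold src
  congr 1
  apply le_antisymm
  · exact Finset.min'_le _ _ (by rw [edge_val]; exact Finset.mem_insert_self a {b})
  · apply Finset.le_min'
    intro y hy
    rw [edge_val, Finset.mem_insert, Finset.mem_singleton] at hy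
    rcases hy with rfl | rfl
    · exact le_rfl
    · exact hab.le

/-- The larger vertex of the edge `{a, b}`, `a < b`, is `b`. [folklore] -/
theorem tgt_edge (a b : ι) (hab : a < b) : tgt (edge a b hab) = vertex b := by
  unfold tgt
  congr 1
  apply le_antisymm
  · apply Finset.max'_le
    intro y hy
    rw [edge_val, Finset.mem_insert, Finset.mem_singleton] at hy
    rcases hy with rfl | rfl
    · exact hab.le
    · exact le_rfl
  · exact Finset.le_max' _ _ (by
      rw [edge_val]; exact Finset.mem_insert_of_mem (Finset.mem_singleton_self b))

/-- The smaller vertex lies in the edge. [folklore] -/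
theorem src_val_subset (τ : Simplex ι 1) : (src τ).1 ⊆ τ.1 :=
  Finset.singleton_subset_iff.2 (Finset.min'_mem _ _)

/-- The larger vertex lies in the edge. [folklore] -/
theorem tgt_val_subset (τ : Simplex ι 1) : (tgt τ).1 ⊆ τ.1 :=
  Finset.singleton_subset_iff.2 (Finset.max'_mem _ _)

/-! ### `Ker(d⁰ ⊗ κ)` as compatible families -/

variable {A : Type u} [CommRing A] {𝕂 : Type v} [AddCommGroup 𝕂] [Module A 𝕂]
  (F : Finset ι → Submodule A 𝕂) (hF : Monotone F)

/-- The first Čech differential with its source and target written as products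
(`Čⁿ = Π_σ F σ` definitionally). [folklore] -/
abbrev dZero : (∀ σ : Simplex ι 0, F σ.1) →ₗ[A] (∀ τ : Simplex ι 1, F τ.1) := d F hF 0

/-- **`(d g)_τ = g_{max τ} - g_{min τ}`** in `𝕂`, for a `0`-cochain `g` and an edge `τ`.
[folklore] -/
theorem coe_dZero (g : ∀ σ : Simplex ι 0, F σ.1) (τ : Simplex ι 1) :
    ((dZero F hF g) τ : 𝕂) = (g (tgt τ) : 𝕂) - (g (src τ) : 𝕂) := by
  obtain ⟨a, b, hab, rfl⟩ := exists_eq_edge τ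
  have h := coe_d_edge F hF g a b hab
  rw [congr_arg (fun σ => (g σ : 𝕂)) (src_edge a b hab),
    congr_arg (fun σ => (g σ : 𝕂)) (tgt_edge a b hab)]
  exact h

/-- `(d g)_τ = g_{max τ}|_τ - g_{min τ}|_τ` in `F τ`. [folklore] -/
theorem dZero_apply (g : ∀ σ : Simplex ι 0, F σ.1) (τ : Simplex ι 1) :
    (dZero F hF g) τ = Submodule.inclusion (hF (tgt_val_subset τ)) (g (tgt τ)) -
      Submodule.inclusion (hF (src_val_subset τ)) (g (src τ)) :=
  Subtype.ext (coe_dZero F hF g τ)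

variable (κ : Type u) [CommRing κ] [Algebra A κ]

/-- The restriction `κ ⊗ F{min τ} → κ ⊗ F τ` (base change of the inclusion). [folklore] -/
noncomputable def srcMap (τ : Simplex ι 1) :
    κ ⊗[A] F (src τ).1 →ₗ[κ] κ ⊗[A] F τ.1 :=
  (Submodule.inclusion (hF (src_val_subset τ))).baseChange κ

/-- The restriction `κ ⊗ F{max τ} → κ ⊗ F τ` (base change of the inclusion). [folklore] -/
noncomputable def tgtMap (τ : Simplex ι 1) :
    κ ⊗[A] F (tgt τ).1 →ₗ[κ] κ ⊗[A] F τ.1 :=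
  (Submodule.inclusion (hF (tgt_val_subset τ))).baseChange κ

/-- `srcMap` on pure tensors. [folklore] -/
@[simp] theorem srcMap_tmul (τ : Simplex ι 1) (c : κ) (m : F (src τ).1) :
    srcMap F hF κ τ (c ⊗ₜ[A] m) = c ⊗ₜ[A] Submodule.inclusion (hF (src_val_subset τ)) m := rfl

/-- `tgtMap` on pure tensors. [folklore] -/
@[simp] theorem tgtMap_tmul (τ : Simplex ι 1) (c : κ) (m : F (tgt τ).1) :
    tgtMap F hF κ τ (c ⊗ₜ[A] m) = c ⊗ₜ[A] Submodule.inclusion (hF (tgt_val_subset τ)) m := rfl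

/-- **The compatible families**: tuples `(x_σ ∈ κ ⊗_A F σ)_{σ}` over the vertices with
`x_{min τ}|_τ = x_{max τ}|_τ` in `κ ⊗_A F τ` for every edge `τ` — the Čech `Ȟ⁰` of the
base-changed family. [cite: GortzWedhorn2023, Lemma 21.65 (p. 259)] -/
noncomputable def compatibleFamilies : Submodule κ (∀ σ : Simplex ι 0, κ ⊗[A] F σ.1) :=
  piEqualizer src tgt (srcMap F hF κ) (tgtMap F hF κ)

/-- Membership in `compatibleFamilies`. [folklore] -/
theorem mem_compatibleFamilies_iff {x : ∀ σ : Simplex ι 0, κ ⊗[A] F σ.1} :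
    x ∈ compatibleFamilies F hF κ ↔ ∀ τ, srcMap F hF κ τ (x (src τ)) = tgtMap F hF κ τ (x (tgt τ)) :=
  mem_piEqualizer_iff

variable [Fintype ι]

/-- The coordinates `κ ⊗ Π_σ F σ ≅ Π_σ κ ⊗ F σ` of the base-changed `0`-cochains (Mathlib
`TensorProduct.piRight`). [folklore] -/
noncomputable def coordZero :
    κ ⊗[A] (∀ σ : Simplex ι 0, F σ.1) ≃ₗ[κ] ∀ σ : Simplex ι 0, κ ⊗[A] F σ.1 :=
  TensorProduct.piRight A κ κ fun σ : Simplex ι 0 => (F σ.1 : Type v)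

/-- The coordinates `κ ⊗ Π_τ F τ ≅ Π_τ κ ⊗ F τ` of the base-changed `1`-cochains. [folklore] -/
noncomputable def coordOne :
    κ ⊗[A] (∀ τ : Simplex ι 1, F τ.1) ≃ₗ[κ] ∀ τ : Simplex ι 1, κ ⊗[A] F τ.1 :=
  TensorProduct.piRight A κ κ fun τ : Simplex ι 1 => (F τ.1 : Type v)

/-- The `τ`-component of `d⁰ ⊗ κ` in coordinates: `(d⁰ ⊗ κ)(z)_τ = z_{max τ}|_τ - z_{min τ}|_τ`.
[folklore] -/
theorem coordOne_baseChange_dZero (z : κ ⊗[A] (∀ σ : Simplex ι 0, F σ.1)) (τ : Simplex ι 1) :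
    coordOne F κ ((dZero F hF).baseChange κ z) τ =
      tgtMap F hF κ τ (coordZero F κ z (tgt τ)) - srcMap F hF κ τ (coordZero F κ z (src τ)) := by
  induction z using TensorProduct.induction_on with
  | zero => simp only [map_zero, Pi.zero_apply, sub_zero]
  | add x y hx hy => rw [map_add, map_add, Pi.add_apply, hx, hy, map_add, Pi.add_apply,
      Pi.add_apply, map_add, map_add]; abel
  | tmul c g =>
    rw [LinearMap.baseChange_tmul]
    unfold coordOne coordZero
    rw [TensorProduct.piRight_apply, TensorProduct.piRight_apply, TensorProduct.piRightHom_tmul,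
      TensorProduct.piRightHom_tmul]
    change c ⊗ₜ[A] (dZero F hF g) τ = tgtMap F hF κ τ (c ⊗ₜ[A] g (tgt τ)) -
      srcMap F hF κ τ (c ⊗ₜ[A] g (src τ))
    rw [dZero_apply, TensorProduct.tmul_sub, tgtMap_tmul, srcMap_tmul]

/-- A base-changed `0`-cochain is a cocycle iff its coordinates form a compatible family.
[folklore] -/
theorem baseChange_dZero_eq_zero_iff (z : κ ⊗[A] (∀ σ : Simplex ι 0, F σ.1)) :
    (dZero F hF).baseChange κ z = 0 ↔ coordZero F κ z ∈ compatibleFamilies F hF κ := by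
  rw [mem_compatibleFamilies_iff, ← (coordOne F κ).map_eq_zero_iff, funext_iff]
  refine forall_congr' fun τ => ?_
  rw [coordOne_baseChange_dZero, Pi.zero_apply, sub_eq_zero, eq_comm]

/-- **`Ker(d⁰ ⊗ κ) ≅` compatible families** (`κ`-linearly): an element of `κ ⊗_A Č⁰` is killed by
`d⁰ ⊗ κ` iff its coordinates `(z_σ)_σ ∈ Π_σ κ ⊗_A F σ` satisfy `z_{min τ}|_τ = z_{max τ}|_τ` for all
edges `τ` — the Čech description `Ȟ⁰ = Ker(Č⁰ → Č¹)` of the base-changed complex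
(Görtz–Wedhorn II, Lemma 21.65 / (23.28.5)). The source is literally the kernel of the base
change of the first differential `OrderedCech.d F hF 0` of `OrderedCech.complex F hF`.
[cite: GortzWedhorn2023, Lemma 21.65 (p. 259)] -/
noncomputable def kerBaseChangeDZeroEquiv :
    LinearMap.ker ((d F hF 0).baseChange κ) ≃ₗ[κ] compatibleFamilies F hF κ :=
  LinearEquiv.ofSubmodules (coordZero F κ) (LinearMap.ker ((dZero F hF).baseChange κ))
    (compatibleFamilies F hF κ) (by
      apply le_antisymm
      · rintro _ ⟨z, hz, rfl⟩
        exact (baseChange_dZero_eq_zero_iff F hF κ z).1 hz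
      · intro x hx
        refine ⟨(coordZero F κ).symm x, ?_, LinearEquiv.apply_symm_apply _ _⟩
        change (dZero F hF).baseChange κ ((coordZero F κ).symm x) = 0
        rw [baseChange_dZero_eq_zero_iff, LinearEquiv.apply_symm_apply]
        exact hx)

/-- The isomorphism `Ker(d⁰ ⊗ κ) ≅` compatible families is `κ ⊗ Π F σ ≅ Π κ ⊗ F σ` on
underlying elements. [folklore] -/
theorem coe_kerBaseChangeDZeroEquiv (z : LinearMap.ker ((d F hF 0).baseChange κ)) :
    ((kerBaseChangeDZeroEquiv F hF κ z : compatibleFamilies F hF κ) :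
        ∀ σ : Simplex ι 0, κ ⊗[A] F σ.1) = coordZero F κ z.1 := rfl

/-- On a pure tensor the coordinates are `(c ⊗ g)_σ = c ⊗ g_σ`. [folklore] -/
@[simp] theorem coordZero_tmul (c : κ) (g : ∀ σ : Simplex ι 0, F σ.1)
    (σ : Simplex ι 0) : coordZero F κ (c ⊗ₜ[A] g) σ = c ⊗ₜ[A] g σ := by
  unfold coordZero
  rw [TensorProduct.piRight_apply, TensorProduct.piRightHom_tmul]

end OrderedCech

end Literature.Algebra.Homology
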